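import Summits.QuantumFields.YangMills.Theorems.TunedSequenceExists.Negative.Glue

/-!
# `TunedSequenceExists` — negative lemma: the canonical exponent `8` is not load-bearing from above

Crux `Summit.QuantumFields.YangMills.Theses.ParabolicTrajectory.TunedSequenceExists` (item
stmt-QuantumFields-10524; cdisprove gen 3, importable extract of § Exponent of the crux workfile
`Summits/QuantumFields/YangMills/Cruxes/TunedSequenceExists/Disproof.lean`).

Replace `(M^{n_k})^8` by `(M^{n_k})^p` in the tuning clause (clause (iii) dropped):

* `lowerBoundPow_mono` — a positive window lower bound with exponent `p` gives one with any
  exponent `q ≥ p` (`M ≥ 1`; positivity of the bound forces the correlator to be `≥ 0` there);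
* `exists_ge_corr_eq_pow`, `weakPow_of_lowerBoundPow`, `lowerBoundPow_of_weakPow` — for EVERY
  exponent the weak body is equivalent to the lower bound (freezing + β-continuity + IVT, as in
  `Negative.Glue` for `p = 8`);
* `weakPow_of_tunedSequenceExists` — hence the crux implies all its exponent-`p ≥ 8` weak
  variants. Reading for planners/provers: the tuning condition alone does not detect the canonical
  scaling dimension `8 = 2·dim(tr F²)`; witnesses of the `p > 8` bodies have
  `N_1(k) = θ (M^{n_k})^{8-p} → 0` (they drift to the Gaussian end `g(ℓ_D) → 0`) — harmless for
  (S), useless for (A). Refuting the `p < 8` bodies would need an a-priori canonical-scaling UPPER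
  bound on `D⁸|⟨P ; τ_D P⟩|` uniformly at weak coupling (UV stability of the composite field),
  which is not in the tree.
-/

noncomputable section

open Filter Topology MeasureTheory
open Literature.MathematicalPhysics.QuantumFieldTheory Literature.MathematicalPhysics.QuantumLattice
open Summit.QuantumFields.YangMills.Theorems.TunedSequenceExists.Negative.Freezing
  (latticeConnectedCorr_curvature_tendsto_zero)
open Summit.QuantumFields.YangMills.Theorems.TunedSequenceExists.Negative.AtZeroFalse
  (tendsto_exponent_of_shape eventually_sep_le_L)
open Summit.QuantumFields.YangMills.Theorems.TunedSequenceExists.Negative.Glue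
  (continuous_latticeConnectedCorr_curvature lowerBound_of_tunedSequenceExists)

namespace Summit.QuantumFields.YangMills.Theorems.TunedSequenceExists.Negative.Exponent

section Exponent

variable {G : Type} [Group G] [TopologicalSpace G] [IsTopologicalGroup G] [CompactSpace G]
  [MeasurableSpace G] [BorelSpace G]

/-- **Raising the exponent only weakens the lower bound** (`M ≥ 1`). -/
theorem lowerBoundPow_mono (r : LatticeRep G) {M : ℕ} (hM : 1 ≤ M) {p q : ℕ} (hpq : p ≤ q)
    (h : ∃ θ₀ : ℝ, 0 < θ₀ ∧ ∀ (B : ℝ) (m₀ L₀ : ℕ), ∃ m : ℕ, m₀ ≤ m ∧ ∃ L : ℕ, L₀ * M ^ m ≤ L ∧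
      ∃ β : ℝ, B ≤ β ∧ θ₀ ≤ ((M : ℝ) ^ m) ^ p *
        latticeConnectedCorr r.ρ β (2 * L + 1) r.curvature.F r.curvature.F (M ^ m)) :
    ∃ θ₀ : ℝ, 0 < θ₀ ∧ ∀ (B : ℝ) (m₀ L₀ : ℕ), ∃ m : ℕ, m₀ ≤ m ∧ ∃ L : ℕ, L₀ * M ^ m ≤ L ∧
      ∃ β : ℝ, B ≤ β ∧ θ₀ ≤ ((M : ℝ) ^ m) ^ q *
        latticeConnectedCorr r.ρ β (2 * L + 1) r.curvature.F r.curvature.F (M ^ m) := by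
  obtain ⟨θ₀, hθ₀, h⟩ := h
  refine ⟨θ₀, hθ₀, fun B m₀ L₀ => ?_⟩
  obtain ⟨m, hm, L, hL, β, hβ, hθ⟩ := h B m₀ L₀
  refine ⟨m, hm, L, hL, β, hβ, hθ.trans ?_⟩
  have hD : (1 : ℝ) ≤ (M : ℝ) ^ m := one_le_pow₀ (by exact_mod_cast hM)
  have hDp : (0 : ℝ) < ((M : ℝ) ^ m) ^ p := by positivity
  have hc : 0 ≤ latticeConnectedCorr r.ρ β (2 * L + 1) r.curvature.F r.curvature.F (M ^ m) := by
    by_contra hneg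
    have : ((M : ℝ) ^ m) ^ p *
        latticeConnectedCorr r.ρ β (2 * L + 1) r.curvature.F r.curvature.F (M ^ m) < 0 :=
      mul_neg_of_pos_of_neg hDp (not_le.1 hneg)
    linarith
  exact mul_le_mul_of_nonneg_right (pow_le_pow_right₀ hD hpq) hc

/-- Exact tuning at one lattice, exponent `p`: if `(M^m)^p · corr ≥ θ₀ > θ > 0` at `β*`, it EQUALS
`θ` at some `β ≥ β*` (continuity + freezing + IVT). -/
theorem exists_ge_corr_eq_pow (r : LatticeRep G) (M m L p : ℕ) {θ θ₀ βstar : ℝ} (hθ : 0 < θ)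
    (hθθ₀ : θ < θ₀) (hstar : θ₀ ≤ ((M : ℝ) ^ m) ^ p *
      latticeConnectedCorr r.ρ βstar (2 * L + 1) r.curvature.F r.curvature.F (M ^ m)) :
    ∃ β : ℝ, βstar ≤ β ∧ ((M : ℝ) ^ m) ^ p *
      latticeConnectedCorr r.ρ β (2 * L + 1) r.curvature.F r.curvature.F (M ^ m) = θ := by
  set f : ℝ → ℝ := fun β => ((M : ℝ) ^ m) ^ p *
    latticeConnectedCorr r.ρ β (2 * L + 1) r.curvature.F r.curvature.F (M ^ m) with hf
  have hfc : Continuous f :=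
    continuous_const.mul (continuous_latticeConnectedCorr_curvature r (2 * L + 1) (M ^ m))
  have hlim : Tendsto f atTop (𝓝 0) := by
    have := (latticeConnectedCorr_curvature_tendsto_zero r (2 * L + 1) (M ^ m)).const_mul
      (((M : ℝ) ^ m) ^ p)
    rwa [mul_zero] at this
  obtain ⟨β₂, hβ₂⟩ := eventually_atTop.1 ((hlim.eventually (gt_mem_nhds hθ)).and
    (eventually_ge_atTop βstar))
  obtain ⟨hlt, hge⟩ := hβ₂ β₂ le_rfl
  have hIVT := intermediate_value_Icc' hge hfc.continuousOn
  obtain ⟨β, hβmem, hβeq⟩ := hIVT ⟨hlt.le, by simpa [hf] using hθθ₀.le.trans hstar⟩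
  exact ⟨β, hβmem.1, hβeq⟩

/-- **Lower bound ⇒ weak body, any exponent** (exact tuning `(M^{n_k})^p · corr = θ` at every
`k`; floors `β_k ≥ k`, `n_k ≥ k`, `L_k ≥ k M^{n_k}`). -/
theorem weakPow_of_lowerBoundPow (r : LatticeRep G) {M : ℕ} (hM : 2 ≤ M) (p : ℕ)
    (h : ∃ θ₀ : ℝ, 0 < θ₀ ∧ ∀ (B : ℝ) (m₀ L₀ : ℕ), ∃ m : ℕ, m₀ ≤ m ∧ ∃ L : ℕ, L₀ * M ^ m ≤ L ∧
      ∃ β : ℝ, B ≤ β ∧ θ₀ ≤ ((M : ℝ) ^ m) ^ p *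
        latticeConnectedCorr r.ρ β (2 * L + 1) r.curvature.F r.curvature.F (M ^ m)) :
    ∃ θ₀ : ℝ, 0 < θ₀ ∧ ∀ θ : ℝ, 0 < θ → θ < θ₀ →
      ∃ (sch : SpeciesScheme (YMSpecies G)) (n : ℕ → ℕ),
        (∀ k, sch.a k = ((M : ℝ) ^ n k)⁻¹) ∧ Tendsto sch.β atTop atTop ∧
        Tendsto (fun k => ((M : ℝ) ^ n k) ^ p *
            latticeConnectedCorr r.ρ (sch.β k) (sch.side k) r.curvature.F r.curvature.F
              (M ^ n k)) atTop (𝓝 θ) := by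
  obtain ⟨θ₀, hθ₀, h⟩ := h
  refine ⟨θ₀, hθ₀, fun θ hθ hθθ₀ => ?_⟩
  choose m hm L hL βs hβs hcorr using fun k : ℕ => h (k : ℝ) k k
  choose β hββs hβeq using fun k : ℕ => exists_ge_corr_eq_pow r M (m k) (L k) p hθ hθθ₀ (hcorr k)
  have hM1 : (1 : ℝ) < M := by exact_mod_cast hM
  have hm_top : Tendsto m atTop atTop := tendsto_atTop_mono hm tendsto_id
  have hpow_top : Tendsto (fun k => (M : ℝ) ^ m k) atTop atTop :=
    (tendsto_pow_atTop_atTop_of_one_lt hM1).comp hm_top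
  let sch : SpeciesScheme (YMSpecies G) :=
    { a := fun k => ((M : ℝ) ^ m k)⁻¹
      a_pos := fun k => by positivity
      tendsto_a := tendsto_inv_atTop_zero.comp hpow_top
      β := β
      L := L
      tendsto_L := by
        refine tendsto_atTop_mono (fun k => ?_) tendsto_natCast_atTop_atTop
        have hLk : (k : ℝ) * (M : ℝ) ^ m k ≤ L k := by exact_mod_cast hL k
        have hp : (0 : ℝ) < (M : ℝ) ^ m k := by positivity
        show (k : ℝ) ≤ ((M : ℝ) ^ m k)⁻¹ * (L k : ℝ)
        rw [inv_mul_eq_div, le_div_iff₀ hp]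
        exact hLk
      c := fun _ _ => 0
      m := fun _ _ => 0 }
  refine ⟨sch, m, fun k => rfl, ?_, ?_⟩
  · exact tendsto_atTop_mono (fun k => (hβs k).trans (hββs k)) tendsto_natCast_atTop_atTop
  · exact tendsto_const_nhds.congr fun k => (hβeq k).symm

/-- **Weak body ⇒ lower bound, any exponent** (constant `θ₀/4`). -/
theorem lowerBoundPow_of_weakPow (r : LatticeRep G) {M : ℕ} (hM : 2 ≤ M) (p : ℕ)
    (h : ∃ θ₀ : ℝ, 0 < θ₀ ∧ ∀ θ : ℝ, 0 < θ → θ < θ₀ →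
      ∃ (sch : SpeciesScheme (YMSpecies G)) (n : ℕ → ℕ),
        (∀ k, sch.a k = ((M : ℝ) ^ n k)⁻¹) ∧ Tendsto sch.β atTop atTop ∧
        Tendsto (fun k => ((M : ℝ) ^ n k) ^ p *
            latticeConnectedCorr r.ρ (sch.β k) (sch.side k) r.curvature.F r.curvature.F
              (M ^ n k)) atTop (𝓝 θ)) :
    ∃ θ₀ : ℝ, 0 < θ₀ ∧ ∀ (B : ℝ) (m₀ L₀ : ℕ), ∃ m : ℕ, m₀ ≤ m ∧ ∃ L : ℕ, L₀ * M ^ m ≤ L ∧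
      ∃ β : ℝ, B ≤ β ∧ θ₀ ≤ ((M : ℝ) ^ m) ^ p *
        latticeConnectedCorr r.ρ β (2 * L + 1) r.curvature.F r.curvature.F (M ^ m) := by
  obtain ⟨θ₀, hθ₀, h⟩ := h
  obtain ⟨sch, n, hshape, hβ, hlim⟩ := h (θ₀ / 2) (by positivity) (by linarith)
  refine ⟨θ₀ / 4, by positivity, fun B m₀ L₀ => ?_⟩
  have hev1 : ∀ᶠ k in atTop, B ≤ sch.β k := tendsto_atTop.1 hβ B
  have hev2 : ∀ᶠ k in atTop, m₀ ≤ n k :=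
    tendsto_atTop.1 (tendsto_exponent_of_shape hM sch hshape) m₀
  have hev3 : ∀ᶠ k in atTop, L₀ * M ^ n k ≤ sch.L k := eventually_sep_le_L sch hshape L₀
  have hθ4 : θ₀ / 4 < θ₀ / 2 := by linarith
  have hev4 : ∀ᶠ k in atTop, θ₀ / 4 < ((M : ℝ) ^ n k) ^ p *
      latticeConnectedCorr r.ρ (sch.β k) (sch.side k) r.curvature.F r.curvature.F (M ^ n k) :=
    hlim.eventually (lt_mem_nhds hθ4)
  obtain ⟨k, hk1, hk2, hk3, hk4⟩ := (hev1.and (hev2.and (hev3.and hev4))).exists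
  exact ⟨n k, hk2, sch.L k, hk3, sch.β k, hk1, hk4.le⟩

end Exponent

/-- **The crux implies every exponent-`p ≥ 8` weak variant of itself** (for all compact simple
`G`, faithful unitary `r`, `M ≥ 2`): the canonical power `8` is not load-bearing from above. -/
theorem weakPow_of_tunedSequenceExists
    (h : Summit.QuantumFields.YangMills.Theses.ParabolicTrajectory.TunedSequenceExists)
    (G : Type) [Group G] [TopologicalSpace G] [IsTopologicalGroup G] [CompactSpace G]
    (hG : IsCompactSimpleLieGroup G) :
    letI : MeasurableSpace G := borel G
    haveI : BorelSpace G := ⟨rfl⟩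
    ∀ (r : LatticeRep G) (M p : ℕ), 2 ≤ M → 8 ≤ p →
      ∃ θ₀ : ℝ, 0 < θ₀ ∧ ∀ θ : ℝ, 0 < θ → θ < θ₀ →
        ∃ (sch : SpeciesScheme (YMSpecies G)) (n : ℕ → ℕ),
          (∀ k, sch.a k = ((M : ℝ) ^ n k)⁻¹) ∧ Tendsto sch.β atTop atTop ∧
          Tendsto (fun k => ((M : ℝ) ^ n k) ^ p *
              latticeConnectedCorr r.ρ (sch.β k) (sch.side k) r.curvature.F r.curvature.F
                (M ^ n k)) atTop (𝓝 θ) := by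
  letI : MeasurableSpace G := borel G
  haveI : BorelSpace G := ⟨rfl⟩
  intro r M p hM hp
  exact weakPow_of_lowerBoundPow r hM p
    (lowerBoundPow_mono r (by omega) hp (lowerBound_of_tunedSequenceExists h G hG r M hM))

end Summit.QuantumFields.YangMills.Theorems.TunedSequenceExists.Negative.Exponent

end
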